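import Literature.Computability.AlgebraicComplexity.LaserFormatPooling
import HarnessLib

/-!
# Laser format data of a pair `t ⊗ t'` — the INPUT data of the laser method are closed under `⊗`

D. Coppersmith, *Rectangular matrix multiplication revisited*, J. Complexity 13 (1997) §3
[Coppersmith1997]; F. Le Gall, *Powers of tensors and fast matrix multiplication* (2014) §5
("if t and t′ are tight partitioned tensors then t ⊗ t′ is tight for the product partition with
supp(t ⊗ t′) = {((i,i′),(j,j′),(l,l′))}") [LeGall2014].

`LaserFormatPooling.laserMethod_hasFormatValue_pair_of_mul` pools TWO factors; its proof builds
the laser data of the pair `t ⊗ t'` (pair labels, pair support, concatenated tightness, block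
format values, product counts, product-form law) as local facts.  This file states those facts
as lemmas, so that a pair can itself be a FACTOR of a further pooling step — iterated pooling
`(t ⊗ t') ⊗ t''`, i.e. arbitrary integer weights `u : v` of Coppersmith's mixture
`CW_q^{⊗u} ⊗ CW_{q'}^{⊗v}` by nesting (used for `(CW_6 ⊗ CW_7) ⊗ CW_7`, `α ≥ 5/17`):

* `pair_support_mem` — the `D`-support of `t ⊗ t'` under pair labels lies in `pairSupport S S'`;
* `pairVal_pos`, `hasFormatValue_pair_blocks` — the pair blocks are the Kronecker products of the
  blocks (`partSubtensor_kronecker`) and have the product format values (`HasFormatValue.kronecker`);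
* `pairCount_eq_zero`, `sum_pairCount`, `pairLaw_eq_pairCount_div`, `law_sum_eq_one'` — the
  product counts `c(s₁) c'(s₂)` over `d d'` present the pair law `P ⊗ P'` as a rational law;
* `pairFactor₁/₂/₃_pos`, `pairLaw_productForm` — product-form laws have a product-form pair law.

All statements are elementary bookkeeping around the cited constructions; no `sorry`.
-/

set_option linter.unusedSectionVars false

noncomputable section

open Finset Real
open scoped BigOperators

universe u

namespace Literature.Computability.AlgebraicComplexity

open Literature.Barriers.MatrixMultiplication

section PairData

variable {K : Type u} [Field K]
variable {ι κ μ ι' κ' μ' : Type*} [Fintype ι] [Fintype κ] [Fintype μ] [Fintype ι'] [Fintype κ']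
  [Fintype μ'] [DecidableEq ι] [DecidableEq κ] [DecidableEq μ] [DecidableEq ι'] [DecidableEq κ']
  [DecidableEq μ']
variable {I J L I' J' L' : Type*} [Fintype I] [Fintype J] [Fintype L] [Fintype I'] [Fintype J']
  [Fintype L'] [DecidableEq I] [DecidableEq J] [DecidableEq L] [DecidableEq I'] [DecidableEq J']
  [DecidableEq L']

/-- **The `D`-support of `t ⊗ t'` under pair labels lies in the pair support.**
[cite: LeGall2014, §5 (p. 10)] -/
theorem pair_support_mem (t : ι → κ → μ → K) (bI : ι → I) (bJ : κ → J) (bL : μ → L)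
    (S : Finset (I × J × L)) (hS : ∀ a b c, t a b c ≠ 0 → (bI a, bJ b, bL c) ∈ S)
    (t' : ι' → κ' → μ' → K) (bI' : ι' → I') (bJ' : κ' → J') (bL' : μ' → L')
    (S' : Finset (I' × J' × L')) (hS' : ∀ a b c, t' a b c ≠ 0 → (bI' a, bJ' b, bL' c) ∈ S') :
    ∀ a b c, kroneckerTensor t t' a b c ≠ 0 →
      ((fun x : ι × ι' => (bI x.1, bI' x.2)) a, (fun y : κ × κ' => (bJ y.1, bJ' y.2)) b,
        (fun z : μ × μ' => (bL z.1, bL' z.2)) c) ∈ pairSupport S S' := by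
  intro a b c h
  rw [kroneckerTensor_apply] at h
  obtain ⟨h1, h2⟩ := mul_ne_zero_iff.mp h
  rw [mem_pairSupport]
  exact ⟨hS a.1 b.1 c.1 h1, hS' a.2 b.2 c.2 h2⟩

/-- Products of data positive on the supports are positive on the pair support (bookkeeping for
the product partition of `t ⊗ t'`). [cite: LeGall2014, §5 (p. 10)] -/
theorem pairVal_pos (S : Finset (I × J × L)) (S' : Finset (I' × J' × L'))
    {f : I × J × L → ℝ} {f' : I' × J' × L' → ℝ} (hf : ∀ s ∈ S, 0 < f s)
    (hf' : ∀ s ∈ S', 0 < f' s) : ∀ s ∈ pairSupport S S', 0 < pairVal f f' s := by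
  intro s hs
  obtain ⟨h1, h2⟩ := mem_pairSupport.1 hs
  exact mul_pos (hf _ h1) (hf' _ h2)

/-- **The pair blocks have the product format values**: the block of `t ⊗ t'` at a pair label
is the Kronecker product of the two blocks (`partSubtensor_kronecker`), and format values
multiply (`HasFormatValue.kronecker`). [cite: LeGall2014, §5 (p. 10); Coppersmith1997, §3] -/
theorem hasFormatValue_pair_blocks (t : ι → κ → μ → K) (bI : ι → I) (bJ : κ → J) (bL : μ → L)
    (S : Finset (I × J × L)) (v fA fB fC : I × J × L → ℝ) (hv : ∀ s ∈ S, 0 < v s)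
    (hfA : ∀ s ∈ S, 0 < fA s) (hfB : ∀ s ∈ S, 0 < fB s) (hfC : ∀ s ∈ S, 0 < fC s)
    (hval : ∀ s ∈ S, HasFormatValue (partSubtensor bI bJ bL t {s.1} {s.2.1} {s.2.2}) (v s)
      (fA s) (fB s) (fC s))
    (t' : ι' → κ' → μ' → K) (bI' : ι' → I') (bJ' : κ' → J') (bL' : μ' → L')
    (S' : Finset (I' × J' × L')) (v' fA' fB' fC' : I' × J' × L' → ℝ) (hv' : ∀ s ∈ S', 0 < v' s)
    (hfA' : ∀ s ∈ S', 0 < fA' s) (hfB' : ∀ s ∈ S', 0 < fB' s) (hfC' : ∀ s ∈ S', 0 < fC' s)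
    (hval' : ∀ s ∈ S', HasFormatValue (partSubtensor bI' bJ' bL' t' {s.1} {s.2.1} {s.2.2})
      (v' s) (fA' s) (fB' s) (fC' s)) :
    ∀ s ∈ pairSupport S S', HasFormatValue
      (partSubtensor (fun x : ι × ι' => (bI x.1, bI' x.2)) (fun y : κ × κ' => (bJ y.1, bJ' y.2))
        (fun z : μ × μ' => (bL z.1, bL' z.2)) (kroneckerTensor t t') {s.1} {s.2.1} {s.2.2})
      (pairVal v v' s) (pairVal fA fA' s) (pairVal fB fB' s) (pairVal fC fC' s) := by
  intro s hs
  obtain ⟨h1, h2⟩ := mem_pairSupport.1 hs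
  obtain ⟨⟨i, i'⟩, ⟨j, j'⟩, ⟨l, l'⟩⟩ := s
  simp only [pairFst, pairSnd] at h1 h2
  simp only [pairVal, pairFst, pairSnd]
  rw [partSubtensor_kronecker bI bJ bL bI' bJ' bL' t t' i j l i' j' l']
  exact (hval (i, j, l) h1).kronecker (hval' (i', j', l') h2) (hv _ h1).le (hv' _ h2).le
    (hfA _ h1).le (hfA' _ h2).le (hfB _ h1).le (hfB' _ h2).le (hfC _ h1).le (hfC' _ h2).le

/-- The product counts vanish off the pair support (the product type of `t ⊗ t'`).
[cite: LeGall2014, §5 (p. 10)] -/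
theorem pairCount_eq_zero (S : Finset (I × J × L)) (S' : Finset (I' × J' × L'))
    {c : I × J × L → ℕ} {c' : I' × J' × L' → ℕ} (hcS : ∀ s, s ∉ S → c s = 0)
    (hcS' : ∀ s, s ∉ S' → c' s = 0) :
    ∀ s, s ∉ pairSupport S S' → c (pairFst s) * c' (pairSnd s) = 0 := by
  intro s hs
  rw [mem_pairSupport, not_and_or] at hs
  rcases hs with hs | hs
  · rw [hcS _ hs, zero_mul]
  · rw [hcS' _ hs, mul_zero]

/-- The product counts have total `d d'` (the product type of `t ⊗ t'`).
[cite: LeGall2014, §5 (p. 10)] -/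
theorem sum_pairCount {c : I × J × L → ℕ} {c' : I' × J' × L' → ℕ} {d d' : ℕ}
    (hc : ∑ s, c s = d) (hc' : ∑ s, c' s = d') :
    ∑ s : (I × I') × (J × J') × (L × L'), c (pairFst s) * c' (pairSnd s) = d * d' := by
  rw [sum_pair_mul, hc, hc']

/-- The pair law of two rational laws is the rational law of the product counts.
[cite: LeGall2014, §5 (p. 10)] -/
theorem pairLaw_eq_pairCount_div {c : I × J × L → ℕ} {c' : I' × J' × L' → ℕ} {d d' : ℕ}
    {P : I × J × L → ℝ} {P' : I' × J' × L' → ℝ} (hP : ∀ s, P s = (c s : ℝ) / d)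
    (hP' : ∀ s, P' s = (c' s : ℝ) / d') :
    ∀ s, pairLaw P P' s = ((c (pairFst s) * c' (pairSnd s) : ℕ) : ℝ) / (d * d' : ℕ) := by
  intro s
  simp only [pairLaw, hP, hP', Nat.cast_mul]
  rw [div_mul_div_comm]

/-- A rational law `P = c/d` with `Σ c = d > 0` vanishing (through `c`) off `S` has mass one,
over the whole label set and over `S` (types as probability distributions on the support).
[cite: LeGall2014, §4 (p. 8)] -/
theorem law_sum_eq_one' {S : Finset (I × J × L)} {c : I × J × L → ℕ}
    (hcS : ∀ s, s ∉ S → c s = 0) {d : ℕ} (hd : 0 < d) (hc : ∑ s, c s = d) {P : I × J × L → ℝ}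
    (hP : ∀ s, P s = (c s : ℝ) / d) : ∑ s, P s = 1 ∧ ∑ s ∈ S, P s = 1 := by
  have hd' : (d : ℝ) ≠ 0 := by exact_mod_cast hd.ne'
  have h1 : ∑ s, P s = 1 := by
    simp_rw [hP, ← Finset.sum_div]
    rw [← Nat.cast_sum, hc, div_self hd']
  refine ⟨h1, ?_⟩
  rw [← h1, ← Finset.sum_subset (Finset.subset_univ S) fun s _ hs => by rw [hP, hcS s hs]; simp]

/-- Product factors positive on the supports give a first pair factor positive on the pair
support (product distributions on `supp(t ⊗ t')`). [cite: LeGall2014, §5 (p. 10)] -/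
theorem pairFactor₁_pos (S : Finset (I × J × L)) (S' : Finset (I' × J' × L')) {f : I → ℝ}
    {f' : I' → ℝ} (hf : ∀ x ∈ S, 0 < f x.1) (hf' : ∀ x ∈ S', 0 < f' x.1) :
    ∀ x ∈ pairSupport S S', 0 < (fun i : I × I' => f i.1 * f' i.2) x.1 := by
  intro x hx
  obtain ⟨h1, h2⟩ := mem_pairSupport.1 hx
  exact mul_pos (hf _ h1) (hf' _ h2)

/-- Second pair factor positive on the pair support (product distributions on `supp(t ⊗ t')`).
[cite: LeGall2014, §5 (p. 10)] -/
theorem pairFactor₂_pos (S : Finset (I × J × L)) (S' : Finset (I' × J' × L')) {g : J → ℝ}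
    {g' : J' → ℝ} (hg : ∀ x ∈ S, 0 < g x.2.1) (hg' : ∀ x ∈ S', 0 < g' x.2.1) :
    ∀ x ∈ pairSupport S S', 0 < (fun j : J × J' => g j.1 * g' j.2) x.2.1 := by
  intro x hx
  obtain ⟨h1, h2⟩ := mem_pairSupport.1 hx
  exact mul_pos (hg _ h1) (hg' _ h2)

/-- Third pair factor positive on the pair support (product distributions on `supp(t ⊗ t')`).
[cite: LeGall2014, §5 (p. 10)] -/
theorem pairFactor₃_pos (S : Finset (I × J × L)) (S' : Finset (I' × J' × L')) {h : L → ℝ}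
    {h' : L' → ℝ} (hh : ∀ x ∈ S, 0 < h x.2.2) (hh' : ∀ x ∈ S', 0 < h' x.2.2) :
    ∀ x ∈ pairSupport S S', 0 < (fun l : L × L' => h l.1 * h' l.2) x.2.2 := by
  intro x hx
  obtain ⟨h1, h2⟩ := mem_pairSupport.1 hx
  exact mul_pos (hh _ h1) (hh' _ h2)

/-- **Product-form laws have a product-form pair law** `(P ⊗ P')((i,i'),(j,j'),(l,l')) =
(f(i)f'(i')) (g(j)g'(j')) (h(l)h'(l'))` on the pair support. [cite: LeGall2014, §5 (p. 10);
Coppersmith1997, §3] -/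
theorem pairLaw_productForm (S : Finset (I × J × L)) (S' : Finset (I' × J' × L'))
    {P : I × J × L → ℝ} {P' : I' × J' × L' → ℝ} (f : I → ℝ) (g : J → ℝ) (h : L → ℝ)
    (hprod : ∀ x ∈ S, P x = f x.1 * g x.2.1 * h x.2.2) (f' : I' → ℝ) (g' : J' → ℝ)
    (h' : L' → ℝ) (hprod' : ∀ x ∈ S', P' x = f' x.1 * g' x.2.1 * h' x.2.2) :
    ∀ x ∈ pairSupport S S', pairLaw P P' x = (fun i : I × I' => f i.1 * f' i.2) x.1 *
      (fun j : J × J' => g j.1 * g' j.2) x.2.1 * (fun l : L × L' => h l.1 * h' l.2) x.2.2 := by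
  intro x hx
  obtain ⟨h1, h2⟩ := mem_pairSupport.1 hx
  simp only [pairLaw]
  rw [hprod _ h1, hprod' _ h2]
  simp only [pairFst, pairSnd]
  ring

end PairData

end Literature.Computability.AlgebraicComplexity
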